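import Summits.BirchSwinnertonDyer.Rank1Residual.Additive.X3BranchResidualCountOfCharacterFacts
import Summits.BirchSwinnertonDyer.Rank1Residual.Additive.X3BranchCertificateRoadMult
import Literature.NumberTheory.EllipticCurves.GreenbergVatsal2000.ResidualLiftingEven
import HarnessLib

/-!
# X3♯(M), NON-degenerate rows, rank `0`, every odd `p`: the CERTIFICATE-ROAD end states with the
# residual-count evaluation `hn` DISCHARGED by the character sentences of GV pp. 41–42 at a twist —
# `Typed.MissingLowerBoundAt W p` and `BSD(E,p)` from PUBLISHED records + the line datum + THREE
# per-pair instrument certificates (`hcert`, `hCcert`, `hDcert`)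
# (cell `bsd-eis`, seat `bsd-eis-x3` gen 3; route K1 `AdditiveBranchIMC`, crux `MultLower` — supports only)

HONEST FRAMING (cell `bsd-eis`, `run/shared/lean/pub/bsd-eis/README.md` §4): THEOREMS ONLY (no
`def`, no named fact, no `sorry`); nothing is booked by this file; NOT a class theorem. Binder diff
w.r.t. the gen-2 end states of `X3BranchCertificateRoadMult.lean` §2–§3: {`hn` (the EVALUATION
`p^{n + Σδ} = #H¹·#U`, not an instrument datum)} ↦ {`hC`, `hD` (the PUBLISHED twisted character facts
`characterLFunction{C,D}_hasUnitContent_and_order_eq_card_of_ne_{one,teichmuller}`: GV pp. 41–42 at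
a twist, Ferrero–Washington, Mazur–Wiles for any abelian field, Props. (2.6)/(2.8)), `hCcert`,
`hDcert` (two ANALYTIC `λ`-certificates: the `𝔽_p⟦T⟧`-orders `a`, `b` of the reductions of
`L_{Σ₀}(C ⊗ χ, T)`, `L_{Σ₀}(D ⊗ χ, T)` — generalized Bernoulli numbers of the characters of `Φ₀` and
`W[p]/Φ₀`), `hab : a + b = n + Σ_{v∈Σ₀} δ_v(W)`}. With them every per-pair input of the non-degenerate
X3♯(M) certificate road is an INSTRUMENT datum or a kernel-decidable line datum (+ the reading-fact
lifting `hlift`); everything else is a PUBLISHED record; no analytic congruence `hGVM` (NOT in print on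
these rows) is used.

* `X3Branch.lamEqW_mult_of_facts_of_lifting_of_charCerts`;
* `ClassX3M.missingLowerBoundAt_rankZero_of_unitCoeffCert_of_charCerts`,
  `ClassX3M.bsdp_rankZero_of_unitCoeffCert_of_charCerts`, and `…_of_liftingFact` (the lifting `hlift`
  discharged by the reading-fact `residualEpsilon_surjOn_of_lineEven`).

What this is NOT: not the DEGENERATE rows (`φ = 1`, `ψ = ω`: `X3BranchDegenerateEndState*.lean`, whose
`hn` is class-field theory of `ℚ_∞`, not a character `L`-function); not rank `1`; not a booking.

References: [GreenbergVatsal2000] §2 pp. 26–30, §3 pp. 41–43; [Greenberg2001PastPresent] §6 p. 367;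
[Delbourgo1998] Prop. 4; [Wuthrich2014] Thm. 16; [Pal2012] Thm. 3.2; [GreenbergLNM1716] Prop. 4.14;
[SilvermanATAEC1994] V.5.3–5.4; [Miller2011LMS] Def. 1.1.
-/

set_option autoImplicit false

noncomputable section

open scoped Classical

namespace Summit.BirchSwinnertonDyer.Rank1Residual.Additive

open WeierstrassCurve NumberField IsDedekindDomain Field
  Literature.NumberTheory.EllipticCurves
  Literature.NumberTheory.EllipticCurves.ModularForms
  Literature.NumberTheory.EllipticCurves.GreenbergVatsal2000
  Literature.NumberTheory.EllipticCurves.Rank1Residual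
  Literature.NumberTheory.EllipticCurves.Rank1Residual.Typed
  Literature.NumberTheory.GaloisRepresentations
  Summit.BirchSwinnertonDyer.Rank1Residual.X1.MuLambda
  Summit.BirchSwinnertonDyer.Rank1Residual.AdditivePotMult
  Summit.BirchSwinnertonDyer.Rank1Residual.Additive.X3Branch

variable {W : WeierstrassCurve ℚ} [W.IsElliptic] [W.IsGloballyMinimal] {p : ℕ} [hp : Fact p.Prime]

/-! ### X3♯(M): `hLamW` and the end states from the character facts + three certificates -/

/-- **(M): `hLamW` from the PUBLISHED records `h23`, `h414`, `hT40`, `hT41`, `hC`, `hD` + the line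
datum (`Φ₀` even with non-trivial action, `χ`-twist ramified) + the reading-fact lifting `hlift` +
two `λ`-certificates** — `X3Branch.lamEqW_mult_of_facts_of_lifting_of_eval` with its `hn` supplied
by `X3Branch.eval_of_charFacts_of_certs`. [cite: GreenbergVatsal2000, §2 (11), (16), pp. 26–30, Props. (2.6), (2.8), Cor. (2.3); §3 pp. 41–43]
[cite: GreenbergLNM1716, Prop. 4.14] [cite: SilvermanATAEC1994, Ch. V Thm. 5.3, Cor. 5.4] -/
theorem X3Branch.lamEqW_mult_of_facts_of_lifting_of_charCerts
    (h23 : datumSelmer_nonPrimitive_invariants)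
    (h414 : Greenberg1999.prop414_noFiniteSubmodule_of_not_dvd_torsionOrder)
    (hT40 : Silverman1994_thmV53_tateUniformisation.{0})
    (hT41 : Silverman1994_thmV53_corV54_tateUniformisation.{0})
    (hC : characterLFunctionC_hasUnitContent_and_order_eq_card_of_ne_one)
    (hD : characterLFunctionD_hasUnitContent_and_order_eq_card_of_ne_teichmuller)
    (hp2 : p ≠ 2) (hpm : AdditivePotMult.PotMult W p) (V : WeierstrassCurve ℚ) [V.IsElliptic]
    [V.IsGloballyMinimal] (hmult : Mult V p) {C : VariableChange ℚ}
    (hCV : C • V.quadraticTwist ((-1 : ℚ) ^ (p / 2) * p) = W)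
    (S₀ : Finset (HeightOneSpectrum (𝓞 ℚ))) (hS₀ : ∀ v ∈ S₀, ((p : ℕ) : 𝓞 ℚ) ∉ v.asIdeal)
    (hS : ∀ v : HeightOneSpectrum (𝓞 ℚ), v ∉ S₀ → ((p : ℕ) : 𝓞 ℚ) ∉ v.asIdeal →
      W.HasGoodReductionAt v)
    (Φ₀ : AddSubgroup (W.geomTorsion (p : ℤ))) (hΦ : IsRationalLine W p Φ₀)
    (heven : LineEven W p Φ₀)
    (hnt : ∃ (σ : absoluteGaloisGroup ℚ) (P : W.geomTorsion (p : ℤ)), P ∈ Φ₀ ∧ σ • P ≠ P)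
    (hram : ∀ (K : Type) [Field K] [NumberField K] [(galRange (K := ℚ) K).Normal],
      Module.finrank ℚ K = 2 → (∃ θ : K, θ ^ 2 = algebraMap ℚ K ((-1) ^ (p / 2) * p)) →
      ¬ ∀ v : HeightOneSpectrum (𝓞 ℚ), ((p : ℕ) : 𝓞 ℚ) ∈ v.asIdeal →
        ∀ 𝔓 ∈ v.primesAbove, ∀ σ ∈ 𝔓.inertia (absoluteGaloisGroup ℚ), ∀ P ∈ Φ₀,
          σ • P = (if σ ∈ galRange (K := ℚ) K then P else -P))
    (hlift : ∀ (κ : ZpExtension ℚ p), κ.IsCyclotomic →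
      ∀ s ∈ residualQuotSelmer W p κ S₀ Φ₀ hΦ, ∃ x ∈ residualTorsionH1 W p κ S₀,
        residualEpsilon W p κ Φ₀ hΦ x = s)
    {a b n : ℕ} (hab : a + b = n + ∑ v ∈ S₀, delta W p v)
    (hCcert : ∀ (m : ℕ) [NeZero m] (φ : DirichletCharacter (ZMod p) m), φ.IsPrimitive →
      (∀ (σ : absoluteGaloisGroup ℚ), ∀ P ∈ Φ₀,
        σ • P = (φ ((modNCyclotomicCharacter ℚ m σ : (ZMod m)ˣ) : ZMod m)).val • P) →
      ∀ g : IwasawaAlgebra p, IsCharacterLFunctionC p φ S₀ g →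
        (PowerSeries.map (PadicInt.toZMod (p := p)) g).order.toNat = a)
    (hDcert : ∀ (d : ℕ) [NeZero d] (ψ : DirichletCharacter (ZMod p) d), ψ.IsPrimitive →
      (∀ (σ : absoluteGaloisGroup ℚ) (P : W.geomTorsion (p : ℤ)),
        σ • P - (ψ ((modNCyclotomicCharacter ℚ d σ : (ZMod d)ˣ) : ZMod d)).val • P ∈ Φ₀) →
      ∀ g : IwasawaAlgebra p, IsCharacterLFunctionD p ψ S₀ g →
        (PowerSeries.map (PadicInt.toZMod (p := p)) g).order.toNat = b)
    {κ : ZpExtension ℚ p} {γ : Field.absoluteGaloisGroup ℚ} (D : W.SelmerDualData κ γ)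
    (g : IwasawaAlgebra p) (hκ : κ.IsCyclotomic) (hγ : κ.IsTopGenerator γ) (hDt : D.IsTorsion)
    (hchar : D.charIdeal = Ideal.span {g}) (hμg : HasUnitContent g) : lam g = n :=
  X3Branch.lamEqW_mult_of_facts_of_lifting_of_eval h23 h414 hT40 hT41 hp2 hpm V hmult hCV S₀ hS₀ hS Φ₀
    hΦ heven hnt hram hlift
    (X3Branch.eval_of_charFacts_of_certs hC hD hp2 S₀ hS₀ hS Φ₀ hΦ heven hnt hab hCcert hDcert)
    D g hκ hγ hDt hchar hμg

/-- **X3♯(M) ∧ `r_an = 0`, NON-degenerate rows, every odd `p`: `Typed.MissingLowerBoundAt W p`** —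
the currency of route K1's crux `MultLower` — from the PUBLISHED records `hDelX`, `hPal`, `hGZK`,
`hmod`, `hmodD`, `hW16`, `h23`, `h414`, `hT40`, `hT41`, `hC`, `hD` + the line datum + `hlift` + the
THREE instrument certificates `hcert`, `hCcert`, `hDcert` (+ the bookkeeping `hab`). No analytic
congruence (`hGVM`) and no residual-count evaluation (`hn`) is displayed. NOT a class theorem.
[cite: Delbourgo1998, Prop. 4 (p. 144)] [cite: Pal2012, Thm. 3.2] [cite: Wuthrich2014, Thm. 16 (p. 397)]
[cite: GreenbergVatsal2000, §2 pp. 26–30, §3 pp. 41–43] [cite: SilvermanATAEC1994, V.5.3, V.5.4] -/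
theorem ClassX3M.missingLowerBoundAt_rankZero_of_unitCoeffCert_of_charCerts
    (hDelX : Delbourgo1998.prop4_rankZero_constantCoeff_eq_unit_mul_of_potMult)
    (hPal : Pal2012.thm32_sqrt_mul_realPeriodRat_twist_eq_of_prime_one_mod_four)
    (hGZK : rank_eq_analyticRank_of_analyticRank_le_one) (hmod : hasEntireLFunction_rat)
    (hmodD : nonempty_modularParametrizationData)
    (hW16 : Wuthrich2014.thm16_halfEigenCharIdeal_dvd_cyclotomicPrime)
    (h23 : datumSelmer_nonPrimitive_invariants)
    (h414 : Greenberg1999.prop414_noFiniteSubmodule_of_not_dvd_torsionOrder)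
    (hT40 : Silverman1994_thmV53_tateUniformisation.{0})
    (hT41 : Silverman1994_thmV53_corV54_tateUniformisation.{0})
    (hC : characterLFunctionC_hasUnitContent_and_order_eq_card_of_ne_one)
    (hD : characterLFunctionD_hasUnitContent_and_order_eq_card_of_ne_teichmuller)
    (hX : ClassX3M W p) (hr : W.analyticRank = 0)
    (S₀ : Finset (HeightOneSpectrum (𝓞 ℚ))) (hS₀ : ∀ v ∈ S₀, ((p : ℕ) : 𝓞 ℚ) ∉ v.asIdeal)
    (hS : ∀ v : HeightOneSpectrum (𝓞 ℚ), v ∉ S₀ → ((p : ℕ) : 𝓞 ℚ) ∉ v.asIdeal →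
      W.HasGoodReductionAt v)
    (Φ₀ : AddSubgroup (W.geomTorsion (p : ℤ))) (hΦ : IsRationalLine W p Φ₀)
    (heven : LineEven W p Φ₀)
    (hnt : ∃ (σ : absoluteGaloisGroup ℚ) (P : W.geomTorsion (p : ℤ)), P ∈ Φ₀ ∧ σ • P ≠ P)
    (hram : ∀ (K : Type) [Field K] [NumberField K] [(galRange (K := ℚ) K).Normal],
      Module.finrank ℚ K = 2 → (∃ θ : K, θ ^ 2 = algebraMap ℚ K ((-1) ^ (p / 2) * p)) →
      ¬ ∀ v : HeightOneSpectrum (𝓞 ℚ), ((p : ℕ) : 𝓞 ℚ) ∈ v.asIdeal →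
        ∀ 𝔓 ∈ v.primesAbove, ∀ σ ∈ 𝔓.inertia (absoluteGaloisGroup ℚ), ∀ P ∈ Φ₀,
          σ • P = (if σ ∈ galRange (K := ℚ) K then P else -P))
    (hlift : ∀ (κ : ZpExtension ℚ p), κ.IsCyclotomic →
      ∀ s ∈ residualQuotSelmer W p κ S₀ Φ₀ hΦ, ∃ x ∈ residualTorsionH1 W p κ S₀,
        residualEpsilon W p κ Φ₀ hΦ x = s)
    {a b n : ℕ} (hab : a + b = n + ∑ v ∈ S₀, delta W p v)
    (hcert : ∀ (V : WeierstrassCurve ℚ) [V.IsElliptic] [V.IsGloballyMinimal] (C : VariableChange ℚ),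
      C • V.quadraticTwist ((-1) ^ (p / 2) * p : ℚ) = W → X3BranchUnitCoeffCertAt V p n)
    (hCcert : ∀ (m : ℕ) [NeZero m] (φ : DirichletCharacter (ZMod p) m), φ.IsPrimitive →
      (∀ (σ : absoluteGaloisGroup ℚ), ∀ P ∈ Φ₀,
        σ • P = (φ ((modNCyclotomicCharacter ℚ m σ : (ZMod m)ˣ) : ZMod m)).val • P) →
      ∀ g : IwasawaAlgebra p, IsCharacterLFunctionC p φ S₀ g →
        (PowerSeries.map (PadicInt.toZMod (p := p)) g).order.toNat = a)
    (hDcert : ∀ (d : ℕ) [NeZero d] (ψ : DirichletCharacter (ZMod p) d), ψ.IsPrimitive →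
      (∀ (σ : absoluteGaloisGroup ℚ) (P : W.geomTorsion (p : ℤ)),
        σ • P - (ψ ((modNCyclotomicCharacter ℚ d σ : (ZMod d)ˣ) : ZMod d)).val • P ∈ Φ₀) →
      ∀ g : IwasawaAlgebra p, IsCharacterLFunctionD p ψ S₀ g →
        (PowerSeries.map (PadicInt.toZMod (p := p)) g).order.toNat = b) :
    MissingLowerBoundAt W p := by
  have hp2 : p ≠ 2 := ClassX3M.p_ne_two W p hX
  obtain ⟨V, _, _, C, hmult, hCV⟩ := ClassX3M.exists_mult_pStar_twist_model (W := W) (p := p) hX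
  exact ClassX3M.missingLowerBoundAt_rankZero_of_unitCoeffCert_of_lamEqW hDelX hPal hGZK hmod hmodD hW16
    hX hr hcert
    (fun D g hκ hγ hDt hchar hμg ↦ X3Branch.lamEqW_mult_of_facts_of_lifting_of_charCerts h23 h414 hT40
      hT41 hC hD hp2 (ClassX3M.potMult W p hX) V hmult hCV S₀ hS₀ hS Φ₀ hΦ heven hnt hram hlift hab
      hCcert hDcert D g hκ hγ hDt hchar hμg)

/-- **X3♯(M) ∧ `r_an = 0`, NON-degenerate rows, every odd `p`: Miller's `BSD(E,p)`** from the
PUBLISHED records (+ `hDel98` for the upper half) + the line datum + `hlift` + the THREE instrument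
certificates (certificate road `ClassX3M.bsdp_rankZero_of_unitCoeffCert_of_lamEqW`). NOT a class
theorem; nothing booked. [cite: Delbourgo1998, Prop. 4 (p. 144), Main Conjecture p. 151] [cite: Pal2012, Thm. 3.2]
[cite: Wuthrich2014, Thm. 16 (p. 397)] [cite: GreenbergVatsal2000, §2 pp. 26–30, §3 pp. 41–43]
[cite: Miller2011LMS, §1 and Def. 1.1] -/
theorem ClassX3M.bsdp_rankZero_of_unitCoeffCert_of_charCerts
    (hDel98 : Delbourgo1998.prop4_rankZero_pow_dvd_constantCoeff)
    (hDelX : Delbourgo1998.prop4_rankZero_constantCoeff_eq_unit_mul_of_potMult)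
    (hPal : Pal2012.thm32_sqrt_mul_realPeriodRat_twist_eq_of_prime_one_mod_four)
    (hGZK : rank_eq_analyticRank_of_analyticRank_le_one) (hmod : hasEntireLFunction_rat)
    (hmodD : nonempty_modularParametrizationData)
    (hW16 : Wuthrich2014.thm16_halfEigenCharIdeal_dvd_cyclotomicPrime)
    (h23 : datumSelmer_nonPrimitive_invariants)
    (h414 : Greenberg1999.prop414_noFiniteSubmodule_of_not_dvd_torsionOrder)
    (hT40 : Silverman1994_thmV53_tateUniformisation.{0})
    (hT41 : Silverman1994_thmV53_corV54_tateUniformisation.{0})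
    (hC : characterLFunctionC_hasUnitContent_and_order_eq_card_of_ne_one)
    (hD : characterLFunctionD_hasUnitContent_and_order_eq_card_of_ne_teichmuller)
    (hX : ClassX3M W p) (hr : W.analyticRank = 0)
    (S₀ : Finset (HeightOneSpectrum (𝓞 ℚ))) (hS₀ : ∀ v ∈ S₀, ((p : ℕ) : 𝓞 ℚ) ∉ v.asIdeal)
    (hS : ∀ v : HeightOneSpectrum (𝓞 ℚ), v ∉ S₀ → ((p : ℕ) : 𝓞 ℚ) ∉ v.asIdeal →
      W.HasGoodReductionAt v)
    (Φ₀ : AddSubgroup (W.geomTorsion (p : ℤ))) (hΦ : IsRationalLine W p Φ₀)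
    (heven : LineEven W p Φ₀)
    (hnt : ∃ (σ : absoluteGaloisGroup ℚ) (P : W.geomTorsion (p : ℤ)), P ∈ Φ₀ ∧ σ • P ≠ P)
    (hram : ∀ (K : Type) [Field K] [NumberField K] [(galRange (K := ℚ) K).Normal],
      Module.finrank ℚ K = 2 → (∃ θ : K, θ ^ 2 = algebraMap ℚ K ((-1) ^ (p / 2) * p)) →
      ¬ ∀ v : HeightOneSpectrum (𝓞 ℚ), ((p : ℕ) : 𝓞 ℚ) ∈ v.asIdeal →
        ∀ 𝔓 ∈ v.primesAbove, ∀ σ ∈ 𝔓.inertia (absoluteGaloisGroup ℚ), ∀ P ∈ Φ₀,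
          σ • P = (if σ ∈ galRange (K := ℚ) K then P else -P))
    (hlift : ∀ (κ : ZpExtension ℚ p), κ.IsCyclotomic →
      ∀ s ∈ residualQuotSelmer W p κ S₀ Φ₀ hΦ, ∃ x ∈ residualTorsionH1 W p κ S₀,
        residualEpsilon W p κ Φ₀ hΦ x = s)
    {a b n : ℕ} (hab : a + b = n + ∑ v ∈ S₀, delta W p v)
    (hcert : ∀ (V : WeierstrassCurve ℚ) [V.IsElliptic] [V.IsGloballyMinimal] (C : VariableChange ℚ),
      C • V.quadraticTwist ((-1) ^ (p / 2) * p : ℚ) = W → X3BranchUnitCoeffCertAt V p n)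
    (hCcert : ∀ (m : ℕ) [NeZero m] (φ : DirichletCharacter (ZMod p) m), φ.IsPrimitive →
      (∀ (σ : absoluteGaloisGroup ℚ), ∀ P ∈ Φ₀,
        σ • P = (φ ((modNCyclotomicCharacter ℚ m σ : (ZMod m)ˣ) : ZMod m)).val • P) →
      ∀ g : IwasawaAlgebra p, IsCharacterLFunctionC p φ S₀ g →
        (PowerSeries.map (PadicInt.toZMod (p := p)) g).order.toNat = a)
    (hDcert : ∀ (d : ℕ) [NeZero d] (ψ : DirichletCharacter (ZMod p) d), ψ.IsPrimitive →
      (∀ (σ : absoluteGaloisGroup ℚ) (P : W.geomTorsion (p : ℤ)),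
        σ • P - (ψ ((modNCyclotomicCharacter ℚ d σ : (ZMod d)ˣ) : ZMod d)).val • P ∈ Φ₀) →
      ∀ g : IwasawaAlgebra p, IsCharacterLFunctionD p ψ S₀ g →
        (PowerSeries.map (PadicInt.toZMod (p := p)) g).order.toNat = b) :
    BSDp W p := by
  have hp2 : p ≠ 2 := ClassX3M.p_ne_two W p hX
  obtain ⟨V, _, _, C, hmult, hCV⟩ := ClassX3M.exists_mult_pStar_twist_model (W := W) (p := p) hX
  exact ClassX3M.bsdp_rankZero_of_unitCoeffCert_of_lamEqW hDel98 hDelX hPal hGZK hmod hmodD hW16 hX hr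
    hcert
    (fun D g hκ hγ hDt hchar hμg ↦ X3Branch.lamEqW_mult_of_facts_of_lifting_of_charCerts h23 h414 hT40
      hT41 hC hD hp2 (ClassX3M.potMult W p hX) V hmult hCV S₀ hS₀ hS Φ₀ hΦ heven hnt hram hlift hab
      hCcert hDcert D g hκ hγ hDt hchar hμg)

/-- **X3♯(M) ∧ `r_an = 0`, NON-degenerate rows: `BSD(E,p)` with the residual lifting DISCHARGED by the
reading-fact `residualEpsilon_surjOn_of_lineEven`** (GV p. 30: `H²(ℚ_Σ/ℚ_∞, Φ) = 0` for an even line)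
— per pair: PUBLISHED records + the line datum (`Φ₀` rational, even, non-trivial action, `χ`-twist
ramified: kernel-decidable) + THREE instrument certificates + the bookkeeping `hab`. NOT a class theorem;
nothing booked. [cite: GreenbergVatsal2000, §2 pp. 28–30, §3 pp. 41–43] [cite: Delbourgo1998, Prop. 4 (p. 144)]
[cite: Wuthrich2014, Thm. 16 (p. 397)] [cite: Miller2011LMS, §1 and Def. 1.1] -/
theorem ClassX3M.bsdp_rankZero_of_unitCoeffCert_of_charCerts_of_liftingFact
    (hDel98 : Delbourgo1998.prop4_rankZero_pow_dvd_constantCoeff)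
    (hDelX : Delbourgo1998.prop4_rankZero_constantCoeff_eq_unit_mul_of_potMult)
    (hPal : Pal2012.thm32_sqrt_mul_realPeriodRat_twist_eq_of_prime_one_mod_four)
    (hGZK : rank_eq_analyticRank_of_analyticRank_le_one) (hmod : hasEntireLFunction_rat)
    (hmodD : nonempty_modularParametrizationData)
    (hW16 : Wuthrich2014.thm16_halfEigenCharIdeal_dvd_cyclotomicPrime)
    (h23 : datumSelmer_nonPrimitive_invariants)
    (h414 : Greenberg1999.prop414_noFiniteSubmodule_of_not_dvd_torsionOrder)
    (hT40 : Silverman1994_thmV53_tateUniformisation.{0})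
    (hT41 : Silverman1994_thmV53_corV54_tateUniformisation.{0})
    (hLiftE : residualEpsilon_surjOn_of_lineEven)
    (hC : characterLFunctionC_hasUnitContent_and_order_eq_card_of_ne_one)
    (hD : characterLFunctionD_hasUnitContent_and_order_eq_card_of_ne_teichmuller)
    (hX : ClassX3M W p) (hr : W.analyticRank = 0)
    (S₀ : Finset (HeightOneSpectrum (𝓞 ℚ))) (hS₀ : ∀ v ∈ S₀, ((p : ℕ) : 𝓞 ℚ) ∉ v.asIdeal)
    (hS : ∀ v : HeightOneSpectrum (𝓞 ℚ), v ∉ S₀ → ((p : ℕ) : 𝓞 ℚ) ∉ v.asIdeal →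
      W.HasGoodReductionAt v)
    (Φ₀ : AddSubgroup (W.geomTorsion (p : ℤ))) (hΦ : IsRationalLine W p Φ₀)
    (heven : LineEven W p Φ₀)
    (hnt : ∃ (σ : absoluteGaloisGroup ℚ) (P : W.geomTorsion (p : ℤ)), P ∈ Φ₀ ∧ σ • P ≠ P)
    (hram : ∀ (K : Type) [Field K] [NumberField K] [(galRange (K := ℚ) K).Normal],
      Module.finrank ℚ K = 2 → (∃ θ : K, θ ^ 2 = algebraMap ℚ K ((-1) ^ (p / 2) * p)) →
      ¬ ∀ v : HeightOneSpectrum (𝓞 ℚ), ((p : ℕ) : 𝓞 ℚ) ∈ v.asIdeal →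
        ∀ 𝔓 ∈ v.primesAbove, ∀ σ ∈ 𝔓.inertia (absoluteGaloisGroup ℚ), ∀ P ∈ Φ₀,
          σ • P = (if σ ∈ galRange (K := ℚ) K then P else -P))
    {a b n : ℕ} (hab : a + b = n + ∑ v ∈ S₀, delta W p v)
    (hcert : ∀ (V : WeierstrassCurve ℚ) [V.IsElliptic] [V.IsGloballyMinimal] (C : VariableChange ℚ),
      C • V.quadraticTwist ((-1) ^ (p / 2) * p : ℚ) = W → X3BranchUnitCoeffCertAt V p n)
    (hCcert : ∀ (m : ℕ) [NeZero m] (φ : DirichletCharacter (ZMod p) m), φ.IsPrimitive →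
      (∀ (σ : absoluteGaloisGroup ℚ), ∀ P ∈ Φ₀,
        σ • P = (φ ((modNCyclotomicCharacter ℚ m σ : (ZMod m)ˣ) : ZMod m)).val • P) →
      ∀ g : IwasawaAlgebra p, IsCharacterLFunctionC p φ S₀ g →
        (PowerSeries.map (PadicInt.toZMod (p := p)) g).order.toNat = a)
    (hDcert : ∀ (d : ℕ) [NeZero d] (ψ : DirichletCharacter (ZMod p) d), ψ.IsPrimitive →
      (∀ (σ : absoluteGaloisGroup ℚ) (P : W.geomTorsion (p : ℤ)),
        σ • P - (ψ ((modNCyclotomicCharacter ℚ d σ : (ZMod d)ˣ) : ZMod d)).val • P ∈ Φ₀) →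
      ∀ g : IwasawaAlgebra p, IsCharacterLFunctionD p ψ S₀ g →
        (PowerSeries.map (PadicInt.toZMod (p := p)) g).order.toNat = b) :
    BSDp W p :=
  ClassX3M.bsdp_rankZero_of_unitCoeffCert_of_charCerts hDel98 hDelX hPal hGZK hmod hmodD hW16 h23 h414 hT40
    hT41 hC hD hX hr S₀ hS₀ hS Φ₀ hΦ heven hnt hram
    (fun κ hκ ↦ hLiftE W p κ S₀ Φ₀ hΦ (ClassX3M.p_ne_two W p hX) hκ heven hS₀ hS) hab hcert hCcert hDcert

end Summit.BirchSwinnertonDyer.Rank1Residual.Additive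

end
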